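import Mathlib.Analysis.InnerProductSpace.PiL2
import Mathlib.Analysis.Normed.Operator.LinearIsometry
import Mathlib.Tactic
import Literature.MathematicalPhysics.StatisticalMechanics.BarlowStacking
import Literature.MathematicalPhysics.StatisticalMechanics.LocalMatchingCompactness
import HarnessLib

/-!
# Windows of Barlow stackings: enumeration, near layer points, re-basing of two-way matches

Elementary bookkeeping about the point set `barlowStacking a h s ⊆ ℝ³` (companion of
`BarlowStacking.lean`) and about two-way matched windows of finite configurations, used by the
restacking competitor of the crux `StackingFaultSparsity` (`stmt-AtomisticToContinuum-14296`,
routes `SquareWellLayerCake` / `LaminarSixThreeThree`) and generic: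

* `exists_fin_enum_barlowStacking_dist_le` — the stacking points within `R` of a centre form a
  finite set (the stacking is `min a h`-separated, `le_dist_of_mem_barlowStacking`), enumerated
  injectively by some `Fin N'`;
* `exists_barlowPos_dist_le_of_layer` — every layer `q₁` has a point laterally within `2/√3 · a`
  of any given stacking point `barlowPos a h s k i₀ j₀` (write the label difference as `3q + r`,
  `0 ≤ r < 3`, and take the point `(i₀ - q, j₀ - q)`), hence within `|(q₁ - k) h| + 2` of it for
  `a ≤ 1`;
* `twoWayMatch_rebase` — RE-BASING a two-way `(L, ε)`-match (every point of `S` within `L` of the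
  base `z` is imaged within `ε` of a particle, every particle within `L` of `y i₀` is within `ε` of
  an image) at a matched pair (particle `i'` within `D` of `y i₀` and within `ε` of the image of
  `p'`): the window of `i'` is two-way `(R', 2ε)`-matched based at `p'` whenever `R' + D + ε ≤ L`
  (the linear isometry is unchanged; triangle inequality);
* `exists_four_close_of_card_lt` — pigeonhole: more than `M₀ ≥ 3` integers in an interval
  `[k - M, k + M]` contain four, `q 0 < q 1 < q 2 < q 3`, of span `q 3 - q 0 ≤ 6M/(M₀ - 2)` (sort
  them; the `⌊M₀/3⌋` consecutive quadruple spans telescope to `≤ 2M`).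

All `[folklore]`.
-/

noncomputable section

open Finset

namespace Literature.MathematicalPhysics.StatisticalMechanics

/-! ## Finite enumeration of a window of the stacking -/

/-- **Finite enumeration of a window of a Barlow stacking**: for `0 < a`, `0 < h` the stacking
is `min a h`-separated (`le_dist_of_mem_barlowStacking`), so the points within `R` of a centre
`c` form a finite set, which is the range of an injective map from some `Fin N'`. [folklore] -/
theorem exists_fin_enum_barlowStacking_dist_le (a h : ℝ) (s : ℤ → ℤ)
    (c : EuclideanSpace ℝ (Fin 3)) (R : ℝ) (ha : 0 < a) (hh : 0 < h) :
    ∃ (N' : ℕ) (P : Fin N' → EuclideanSpace ℝ (Fin 3)), Function.Injective P ∧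
      Set.range P = {p ∈ barlowStacking a h s | dist p c ≤ R} := by
  classical
  set T : Set (EuclideanSpace ℝ (Fin 3)) := {p ∈ barlowStacking a h s | dist p c ≤ R} with hT
  have hTsub : T ⊆ Metric.closedBall c R := fun p hp => Metric.mem_closedBall.2 hp.2
  have hsep : ∀ p ∈ T, ∀ q ∈ T, p ≠ q → min a h ≤ dist p q := fun p hp q hq hpq =>
    le_dist_of_mem_barlowStacking a h s ha.le hh.le hp.1 hq.1 hpq
  have hfin : T.Finite :=
    finite_of_forall_le_dist_of_subset_closedBall (lt_min ha hh) hsep hTsub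
  set F : Finset (EuclideanSpace ℝ (Fin 3)) := hfin.toFinset with hF
  refine ⟨F.card, fun i => (F.equivFin.symm i).1, ?_, ?_⟩
  · intro i j hij
    exact F.equivFin.symm.injective (Subtype.ext hij)
  · ext p
    simp only [Set.mem_range]
    constructor
    · rintro ⟨i, rfl⟩
      exact (Set.Finite.mem_toFinset hfin).1 (F.equivFin.symm i).2
    · intro hp
      exact ⟨F.equivFin ⟨p, (Set.Finite.mem_toFinset hfin).2 hp⟩, by simp⟩

/-! ## A point of a given layer close to a given stacking point -/

/-- **A point of layer `q₁` laterally close to a given stacking point**: writing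
`haggLabel s q₁ - haggLabel s k = 3q + r` with `0 ≤ r < 3`, the point `(i₀ - q, j₀ - q)` of layer
`q₁` is laterally within `a r/√3 ≤ 2/√3` of `barlowPos a h s k i₀ j₀` (`0 ≤ a ≤ 1`), hence
within the layer distance `|(q₁ - k) h|` plus `2` of it. [folklore] -/
theorem exists_barlowPos_dist_le_of_layer (a h : ℝ) (s : ℤ → ℤ) (ha : 0 ≤ a) (ha1 : a ≤ 1)
    (q₁ k i₀ j₀ : ℤ) :
    ∃ i₁ j₁ : ℤ, dist (barlowPos a h s q₁ i₁ j₁) (barlowPos a h s k i₀ j₀) ≤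
      |((q₁ : ℝ) - k) * h| + 2 := by
  set Δ : ℤ := haggLabel s q₁ - haggLabel s k with hΔ
  have hdec : haggLabel s q₁ - haggLabel s k = 3 * (Δ / 3) + Δ % 3 := by
    rw [← hΔ]; omega
  have hr0 : 0 ≤ Δ % 3 := Int.emod_nonneg _ (by norm_num)
  have hr3 : Δ % 3 < 3 := Int.emod_lt_of_pos _ (by norm_num)
  refine ⟨i₀ - Δ / 3, j₀ - Δ / 3, ?_⟩
  have h3 : (√3 : ℝ) ^ 2 = 3 := Real.sq_sqrt (by norm_num)
  have hΔr : ((haggLabel s q₁ : ℝ) - haggLabel s k) =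
      3 * ((Δ / 3 : ℤ) : ℝ) + ((Δ % 3 : ℤ) : ℝ) := by
    have := congrArg (Int.cast (R := ℝ)) hdec
    push_cast at this
    linarith
  have hsq : dist (barlowPos a h s q₁ (i₀ - Δ / 3) (j₀ - Δ / 3)) (barlowPos a h s k i₀ j₀) ^ 2 =
      a ^ 2 * ((Δ % 3 : ℤ) : ℝ) ^ 2 / 3 + (((q₁ : ℝ) - k) * h) ^ 2 := by
    rw [dist_barlowPos_sq, hΔr]
    push_cast
    linear_combination (a ^ 2 * ((Δ % 3 : ℤ) : ℝ) ^ 2 / 36) * h3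
  have hr2 : ((Δ % 3 : ℤ) : ℝ) ≤ 2 := by exact_mod_cast (by omega : Δ % 3 ≤ 2)
  have hr0' : (0 : ℝ) ≤ ((Δ % 3 : ℤ) : ℝ) := by exact_mod_cast hr0
  have hv := abs_nonneg (((q₁ : ℝ) - k) * h)
  have hsqle : dist (barlowPos a h s q₁ (i₀ - Δ / 3) (j₀ - Δ / 3)) (barlowPos a h s k i₀ j₀) ^ 2 ≤
      (|((q₁ : ℝ) - k) * h| + 2) ^ 2 := by
    rw [hsq, ← sq_abs (((q₁ : ℝ) - k) * h)]
    have har : a * ((Δ % 3 : ℤ) : ℝ) ≤ 2 := by nlinarith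
    have har0 : 0 ≤ a * ((Δ % 3 : ℤ) : ℝ) := mul_nonneg ha hr0'
    nlinarith
  exact (pow_le_pow_iff_left₀ dist_nonneg (by positivity) two_ne_zero).1 hsqle

/-! ## Re-basing a two-way match -/

/-- **Re-basing a two-way match at a matched pair.**  Let the window of particle `i₀` of the
configuration `y` be two-way `(L, ε)`-matched to the point set `S` based at `z` after the linear
isometry `A` (every `p ∈ S` within `L` of `z` has its image `y i₀ + A (p - z)` within `ε` of a
particle; every particle within `L` of `y i₀` is within `ε` of such an image).  If the particle
`i'` lies within `D` of `y i₀` and within `ε` of the image of `p'`, then the window of `i'` is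
two-way `(R', 2ε)`-matched to `S` based at `p'` after the same `A`, whenever `R' + D + ε ≤ L`:
`y i' + A (q - p') = (y i₀ + A (q - z)) + (y i' - (y i₀ + A (p' - z)))`, the last bracket has
norm `≤ ε`, and `dist p' z ≤ D + ε`. [folklore] -/
theorem twoWayMatch_rebase {N : ℕ} (y : Fin N → EuclideanSpace ℝ (Fin 3)) (i₀ i' : Fin N)
    (S : Set (EuclideanSpace ℝ (Fin 3))) (z p' : EuclideanSpace ℝ (Fin 3))
    (A : EuclideanSpace ℝ (Fin 3) →ₗᵢ[ℝ] EuclideanSpace ℝ (Fin 3)) {L R' D ε : ℝ}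
    (hfit : R' + D + ε ≤ L)
    (hW : (∀ p ∈ S, dist p z ≤ L → ∃ j : Fin N, dist (y j) (y i₀ + A (p - z)) ≤ ε) ∧
      (∀ j : Fin N, dist (y j) (y i₀) ≤ L → ∃ p ∈ S, dist (y j) (y i₀ + A (p - z)) ≤ ε))
    (hD : dist (y i') (y i₀) ≤ D) (hp' : dist (y i') (y i₀ + A (p' - z)) ≤ ε) :
    (∀ p ∈ S, dist p p' ≤ R' → ∃ j : Fin N, dist (y j) (y i' + A (p - p')) ≤ 2 * ε) ∧
      (∀ j : Fin N, dist (y j) (y i') ≤ R' → ∃ p ∈ S, dist (y j) (y i' + A (p - p')) ≤ 2 * ε) := by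
  -- re-centring: the new image points differ from the old ones by a fixed vector of norm `≤ ε`
  have recentre : ∀ q : EuclideanSpace ℝ (Fin 3),
      y i' + A (q - p') = (y i₀ + A (q - z)) + (y i' - (y i₀ + A (p' - z))) := by
    intro q
    have : A (q - p') = A (q - z) - A (p' - z) := by
      rw [← map_sub]; congr 1; abel
    rw [this]; abel
  have hshift : ‖y i' - (y i₀ + A (p' - z))‖ ≤ ε := by rwa [← dist_eq_norm]
  have hmove : ∀ x q : EuclideanSpace ℝ (Fin 3),
      dist x (y i' + A (q - p')) ≤ dist x (y i₀ + A (q - z)) + ε := by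
    intro x q
    rw [recentre q, dist_eq_norm, dist_eq_norm]
    have : x - ((y i₀ + A (q - z)) + (y i' - (y i₀ + A (p' - z)))) =
        (x - (y i₀ + A (q - z))) - (y i' - (y i₀ + A (p' - z))) := by abel
    rw [this]
    exact (norm_sub_le _ _).trans (by gcongr)
  -- distance of `p'` from `z`
  have hp'z : dist p' z ≤ D + ε := by
    have h1 : dist p' z = dist (y i₀ + A (p' - z)) (y i₀) := by
      rw [dist_self_add_left, LinearIsometry.norm_map, dist_eq_norm]
    rw [h1]
    calc dist (y i₀ + A (p' - z)) (y i₀)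
        ≤ dist (y i₀ + A (p' - z)) (y i') + dist (y i') (y i₀) := dist_triangle _ _ _
      _ ≤ ε + D := add_le_add (by rwa [dist_comm]) hD
      _ = D + ε := add_comm _ _
  refine ⟨fun q hq hqp => ?_, fun j hj => ?_⟩
  · -- first clause: stacking points near `p'` are near `z`, hence matched in the big window
    have hqz : dist q z ≤ L := by
      calc dist q z ≤ dist q p' + dist p' z := dist_triangle _ _ _
        _ ≤ R' + (D + ε) := add_le_add hqp hp'z
        _ ≤ L := by linarith
    obtain ⟨j, hj⟩ := hW.1 q hq hqz
    exact ⟨j, (hmove _ q).trans (by linarith)⟩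
  · -- second clause: particles near `y i'` are near `y i₀`, hence matched in the big window
    have hj0 : dist (y j) (y i₀) ≤ L := by
      calc dist (y j) (y i₀) ≤ dist (y j) (y i') + dist (y i') (y i₀) := dist_triangle _ _ _
        _ ≤ R' + D := add_le_add hj hD
        _ ≤ L := by linarith [show (0 : ℝ) ≤ ε from le_trans dist_nonneg hp']
    obtain ⟨q, hq, hqj⟩ := hW.2 j hj0
    exact ⟨q, hq, (hmove _ q).trans (by linarith)⟩

/-! ## Four close elements among many integers of an interval -/

/-- **Four close integers (pigeonhole).**  If more than `M₀ ≥ 3` elements of a finite set `S`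
of integers lie in `[k - M, k + M]`, then `S` contains four elements `q 0 < q 1 < q 2 < q 3` of
span `q 3 - q 0 ≤ 6M / (M₀ - 2)`: sort the elements; the `T = ⌊M₀/3⌋ ≥ (M₀ - 2)/3` consecutive
quadruple spans `c (3t+3) - c (3t)` telescope to `c (3T) - c 0 ≤ 2M`, so one of them is
`≤ 2M/T`. [folklore] -/
theorem exists_four_close_of_card_lt (S : Finset ℤ) (k : ℤ) (M M₀ : ℕ) (hM₀ : 3 ≤ M₀)
    (hS : ∀ m ∈ S, k - M ≤ m ∧ m ≤ k + M) (hcard : M₀ < S.card) :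
    ∃ q : Fin 4 → ℤ, StrictMono q ∧ (∀ t, q t ∈ S) ∧
      ((q 3 : ℝ) - q 0) ≤ 6 * M / ((M₀ : ℝ) - 2) := by
  classical
  set n := S.card with hn
  -- the sorted enumeration of `S`
  set c : Fin n ↪o ℤ := S.orderEmbOfFin rfl with hc
  have hcmem : ∀ i : Fin n, c i ∈ S := fun i => Finset.orderEmbOfFin_mem S rfl i
  -- number of quadruple blocks
  set T : ℕ := M₀ / 3 with hT
  have hT1 : 1 ≤ T := by omega
  have h3T : 3 * T ≤ M₀ := Nat.mul_div_le M₀ 3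
  have h3Tlt : 3 * T < n := lt_of_le_of_lt h3T hcard
  -- spans of consecutive quadruples telescope
  set f : ℕ → ℤ := fun t => if h : 3 * t < n then c ⟨3 * t, h⟩ else 0 with hf
  have hf_eq : ∀ (t : ℕ) (ht : t ≤ T), f t = c ⟨3 * t, by omega⟩ := by
    intro t ht; simp only [hf, dif_pos (show 3 * t < n by omega)]
  have htel : ∑ t ∈ Finset.range T, (f (t + 1) - f t) = f T - f 0 := Finset.sum_range_sub f T
  -- total span ≤ 2M
  have hspan : f T - f 0 ≤ 2 * M := by
    rw [hf_eq T le_rfl, hf_eq 0 (Nat.zero_le _)]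
    have h1 := hS _ (hcmem ⟨3 * T, by omega⟩)
    have h0 := hS _ (hcmem ⟨3 * 0, by omega⟩)
    omega
  -- some quadruple has small span
  have hex : ∃ t ∈ Finset.range T, ((f (t + 1) - f t : ℤ) : ℝ) ≤ 2 * M / T := by
    by_contra hcon
    push Not at hcon
    have hne : (Finset.range T).Nonempty := ⟨0, Finset.mem_range.2 (by omega)⟩
    have hlt : (T : ℝ) * (2 * M / T) < ∑ t ∈ Finset.range T, ((f (t + 1) - f t : ℤ) : ℝ) := by
      calc (T : ℝ) * (2 * M / T) = ∑ _t ∈ Finset.range T, (2 * (M : ℝ) / T) := by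
            rw [Finset.sum_const, Finset.card_range, nsmul_eq_mul]
        _ < _ := Finset.sum_lt_sum_of_nonempty hne fun t ht => hcon t ht
    have hTpos : (0 : ℝ) < T := by exact_mod_cast hT1
    rw [mul_div_cancel₀ _ hTpos.ne'] at hlt
    have hsumcast : ∑ t ∈ Finset.range T, ((f (t + 1) - f t : ℤ) : ℝ) =
        ((f T - f 0 : ℤ) : ℝ) := by
      rw [← htel]; push_cast; rfl
    rw [hsumcast] at hlt
    have : ((f T - f 0 : ℤ) : ℝ) ≤ 2 * M := by exact_mod_cast hspan
    linarith
  obtain ⟨t, ht, hsmall⟩ := hex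
  rw [Finset.mem_range] at ht
  -- the quadruple `c (3t), c (3t+1), c (3t+2), c (3t+3)`
  refine ⟨fun r => c ⟨3 * t + (r : ℕ), by have := r.2; omega⟩, ?_, fun r => hcmem _, ?_⟩
  · intro r r' hrr'
    apply c.strictMono
    rw [Fin.mk_lt_mk]
    exact Nat.add_lt_add_left (Fin.lt_def.1 hrr') _
  · -- span of the chosen quadruple
    have e3 : f (t + 1) = c ⟨3 * t + ((3 : Fin 4) : ℕ), by omega⟩ := by
      rw [hf_eq (t + 1) ht]
      congr 1
    have e0 : f t = c ⟨3 * t + ((0 : Fin 4) : ℕ), by omega⟩ := by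
      rw [hf_eq t ht.le]
      congr 1
    have hTle : (2 : ℝ) * M / T ≤ 6 * M / ((M₀ : ℝ) - 2) := by
      have hTpos : (0 : ℝ) < T := by exact_mod_cast hT1
      have hM₀2 : (0 : ℝ) < (M₀ : ℝ) - 2 := by
        have : (3 : ℝ) ≤ M₀ := by exact_mod_cast hM₀
        linarith
      rw [div_le_div_iff₀ hTpos hM₀2]
      have : ((M₀ : ℝ) - 2) ≤ 3 * T := by
        have h : M₀ ≤ 3 * T + 2 := by omega
        have : (M₀ : ℝ) ≤ 3 * (T : ℝ) + 2 := by exact_mod_cast h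
        linarith
      have hMnn : (0 : ℝ) ≤ M := Nat.cast_nonneg M
      nlinarith
    have hcast : ((f (t + 1) - f t : ℤ) : ℝ) = ((c ⟨3 * t + ((3 : Fin 4) : ℕ), by omega⟩ : ℤ) : ℝ) -
        ((c ⟨3 * t + ((0 : Fin 4) : ℕ), by omega⟩ : ℤ) : ℝ) := by
      rw [e3, e0]; push_cast; ring
    rw [hcast] at hsmall
    linarith

end Literature.MathematicalPhysics.StatisticalMechanics

end
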